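import Mathlib
import HarnessLib
import Literature.Analysis.FluidPDE.TypeIAncientMild
import Literature.Analysis.FluidPDE.ChaeWolfRemovingDSSProofs
import Summits.NavierStokesRegularity.NavierStokesRegularity.Theorems.TypeICertificateLadderTargetAncientPressure
import Summits.NavierStokesRegularity.NavierStokesRegularity.Theorems.SymmetryModuliCountFarPastLedgerReduction
import Summits.NavierStokesRegularity.NavierStokesRegularity.Theorems.SymmetryModuliCountSymmetricLiouvilleRssCoreOfConjecture

/-!
# Crux `ExtremalSpiralSymmetry` (stmt-NavierStokesRegularity-8215), line `registered`:
# one scaling period modulo a rigid motion = rotated discrete self-similarity about a centre;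
# reduction of stub 2 (`stub_continuousOfDiscrete`) to the bounded-profile RDSS Type-I Liouville wall

Support file (theorems only, `--supports stmt-NavierStokesRegularity-8215`; no definitions, no named facts).
Lead c2.

Write `S_c u (t,x) = c u(c²t, cx)` and `g_{b,R} u (t,x) = R u(t, R⁻¹(x - b))` (`R` a linear isometry of `ℝ³`,
`b ∈ ℝ³`). The second registered stub of the line, `stub_continuousOfDiscrete`, assumes an EXTREMAL pair `(C, u)`
of the KNSS-gauge Type-I ancient mild class `A_C` (`IsTypeIAncientMild C u`, written out) with ONE exact scaling
period modulo a rigid motion, `S_c u = g_{b,R} u` on `t < 0`, `c > 0`, `c ≠ 1`. This file proves: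

* `exists_centre_of_period` — for `c ≠ 1` the linear map `c⁻¹ - R` of `ℝ³` is onto (it is injective: `R` is an
  isometry and `c⁻¹ ≠ 1`), so there is a CENTRE `x₀` with `c⁻¹ x₀ - R x₀ = b`;
* `rdss_of_period` — about that centre the period is rotated discrete self-similarity with blow-up time `0`:
  `c Rᵀ u(c²t, x₀ + cRy) = u(t, x₀ + y)` for all `t < 0`, `y` (the tree's `IsRotatedDSS c R` for the translate
  `y ↦ u(t, x₀ + y)`, on the slab);
* `rdss_inv` — the same with `(c, R)` replaced by `(c⁻¹, R⁻¹)`, so the factor may be taken `> 1`;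
* `stub_periodToRDSS` — the three combined: the registered stub 2a of skeleton v5 (name + signature verbatim);
* `period_trivial_of_rdssLiouville` — CONSEQUENTLY, granted the bounded-profile rotated-DSS Type-I Liouville
  statement in the gauge class (hypothesis `hW`, spelled out: every `u ∈ A_C` which is `(c, R)`-RDSS about some
  `(0, x₀)` on `t < 0` with `c > 1` vanishes on `t < 0` — it contains Tsai 2018 Conj. 8.8/8.9 = Bradshaw–Tsai 2017
  Open Problem 5.1 for merely BOUNDED profiles; the tree's walls `TypeIDSSLiouville` / `RotatedTypeIDSSLiouville` and
  crux `RDSSLiouvilleInClass` (stmt-8561) assume in addition SPACE–time decay resp. `𝐈 < ∞`), every element of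
  `A_C` with a scaling period modulo a rigid motion vanishes, and
* `stub_continuousOfDiscrete_of_rdssLiouville` — the registered stub `stub_continuousOfDiscrete` follows from `hW`
  (vacuously: the extremal has `‖u(−1,0)‖ = C > 0`);
* `rdss_trivial_of_spaceDecay_of_conjecture` — the SPACE-DECAYING part of `hW` is exactly catalogued: under the
  tree's conjecture leaf `Summit.NavierStokesRegularity.NavierStokesRegularity.TypeIDSSLiouvilleConjecture`
  (Bradshaw–Tsai OP 5.1 / Tsai Conj. 8.8–8.9, `@[conjecture]`, hypothesis — never asserted) every `u ∈ A_C` which is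
  `(c, R)`-RDSS about `(0, x₀)` on `t < 0`, `c > 1`, with a space–time bound `‖u(t, x₀ + y)‖ ≤ C₀/(‖y‖ + √(−t))`,
  vanishes on `t < 0`; what `hW` asks BEYOND the catalogued conjecture is the bounded-profile case (no spatial decay);
* `rdss_trivial_nearOne_of_spaceDecay` — the one PROVED rung of `hW` inside `A_C`: for every `C₀ > 0` there is
  `c₁ > 1` such that an element of `A_C` which is `c`-DSS about `(0, x₀)` on `t < 0` with `R = 1`, `1 < c < c₁`,
  and obeys the space–time bound `‖u(t, x₀ + y)‖ ≤ C₀/(‖y‖ + √(−t))`, vanishes on `t < 0` (Chae–Wolf 2017 Thm 1.3, in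
  tree as `chaeWolf2017_removing_dss_holds`, fed with the global classical pressure of the class
  `stub_ancientPressure` and the truncation of the translate to `t < 0`).

References: D. Chae, J. Wolf, Comm. PDE 42 (2017) = arXiv:1610.09464, Thm 1.3 [ChaeWolf2017RemovingDSS];
Z. Bradshaw, T.-P. Tsai, Comm. PDE 42 (2017) = arXiv:1610.05680, §5 Open Problem 5.1 [BradshawTsai2017CPDE];
T.-P. Tsai, *Lectures on Navier–Stokes equations*, GSM 192 (2018), Conj. 8.8–8.9 [Tsai2018].
-/

noncomputable section

-- the summit and its single sub-problem share the name (CONVENTIONS §1), as in every Theorems file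
set_option linter.dupNamespace false

open Set MeasureTheory Filter Topology
open Literature.Analysis.FluidPDE

namespace Summit.NavierStokesRegularity.NavierStokesRegularity.Theorems.ExtremalSpiralSymmetry.Registered

/-! ### The centre of a scaling period modulo a rigid motion -/

/-- **Centre of a similarity.** For `c > 0`, `c ≠ 1` and a linear isometry `R` of `ℝ³`, the linear map
`x ↦ c⁻¹ x - R x` is onto: it is injective (`R x = c⁻¹ x` forces `‖x‖ = c⁻¹ ‖x‖`, so `x = 0`) and `ℝ³` is finite
dimensional. Hence every `b` has a centre `x₀` with `c⁻¹ x₀ - R x₀ = b`. [folklore] -/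
theorem exists_centre_of_period {c : ℝ} (hc : 0 < c) (hc1 : c ≠ 1) (R : (EuclideanSpace ℝ (Fin 3)) ≃ₗᵢ[ℝ] (EuclideanSpace ℝ (Fin 3))) (b : (EuclideanSpace ℝ (Fin 3))) :
    ∃ x₀ : (EuclideanSpace ℝ (Fin 3)), c⁻¹ • x₀ - R x₀ = b := by
  set T : (EuclideanSpace ℝ (Fin 3)) →ₗ[ℝ] (EuclideanSpace ℝ (Fin 3)) := c⁻¹ • LinearMap.id - (R.toLinearEquiv : (EuclideanSpace ℝ (Fin 3)) →ₗ[ℝ] (EuclideanSpace ℝ (Fin 3))) with hT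
  have hTapply : ∀ x, T x = c⁻¹ • x - R x := fun x => by
    simp [hT]
  have hinj : Function.Injective T := by
    refine (injective_iff_map_eq_zero T).2 fun x hx => ?_
    rw [hTapply, sub_eq_zero] at hx
    have hn : c⁻¹ * ‖x‖ = ‖x‖ := by
      have h1 : ‖c⁻¹ • x‖ = ‖R x‖ := by rw [hx]
      rwa [norm_smul, LinearIsometryEquiv.norm_map, Real.norm_of_nonneg (inv_pos.2 hc).le] at h1
    have hc' : c⁻¹ ≠ 1 := by
      intro h
      exact hc1 (inv_eq_one.1 h)
    have : (c⁻¹ - 1) * ‖x‖ = 0 := by linarith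
    rcases mul_eq_zero.1 this with h | h
    · exact absurd (sub_eq_zero.1 h) hc'
    · exact norm_eq_zero.1 h
  obtain ⟨x₀, hx₀⟩ := LinearMap.surjective_of_injective hinj b
  exact ⟨x₀, by rw [← hTapply]; exact hx₀⟩

/-- **A scaling period modulo a rigid motion is rotated discrete self-similarity about its centre.** If
`c u(c²t, cx) = R u(t, R⁻¹(x - b))` for all `t < 0`, `x`, with `c > 0`, and `x₀` is a centre
(`c⁻¹ x₀ - R x₀ = b`), then `c Rᵀ u(c²t, x₀ + c R y) = u(t, x₀ + y)` for all `t < 0`, `y` — the translate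
`(t, y) ↦ u(t, x₀ + y)` is `(c, R)`-rotated-discretely-self-similar on the slab (Chae–Wolf 2017, Def. 1.1).
[folklore] -/
theorem rdss_of_period {u : ℝ → (EuclideanSpace ℝ (Fin 3)) → (EuclideanSpace ℝ (Fin 3))} {c : ℝ} (hc : 0 < c) {R : (EuclideanSpace ℝ (Fin 3)) ≃ₗᵢ[ℝ] (EuclideanSpace ℝ (Fin 3))} {b x₀ : (EuclideanSpace ℝ (Fin 3))}
    (hx₀ : c⁻¹ • x₀ - R x₀ = b)
    (h : ∀ t < (0 : ℝ), ∀ x, c • u (c ^ 2 * t) (c • x) = R (u t (R.symm (x - b)))) :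
    ∀ t < (0 : ℝ), ∀ y, c • R.symm (u (c ^ 2 * t) (x₀ + c • R y)) = u t (x₀ + y) := by
  intro t ht y
  have key := h t ht (R y + c⁻¹ • x₀)
  have e1 : c • (R y + c⁻¹ • x₀) = x₀ + c • R y := by
    rw [smul_add, smul_smul, mul_inv_cancel₀ hc.ne', one_smul, add_comm]
  have e2 : R.symm (R y + c⁻¹ • x₀ - b) = x₀ + y := by
    have hb : c⁻¹ • x₀ - b = R x₀ := by rw [← hx₀]; abel
    rw [add_sub_assoc, hb, ← map_add, LinearIsometryEquiv.symm_apply_apply, add_comm]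
  rw [e1, e2] at key
  rw [← LinearIsometryEquiv.map_smul, key, LinearIsometryEquiv.symm_apply_apply]

/-- **Inverting a rotated scaling period.** If `c Rᵀ v(c²t, c R y) = v(t, y)` on `t < 0` with `c > 0`, then
also `c⁻¹ R v(c⁻²t, c⁻¹ R⁻¹ y) = v(t, y)` on `t < 0`: the period `(c, R)` inverts to `(c⁻¹, R⁻¹)`, so the factor
may always be taken `> 1`. [folklore] -/
theorem rdss_inv {v : ℝ → (EuclideanSpace ℝ (Fin 3)) → (EuclideanSpace ℝ (Fin 3))} {c : ℝ} (hc : 0 < c) {R : (EuclideanSpace ℝ (Fin 3)) ≃ₗᵢ[ℝ] (EuclideanSpace ℝ (Fin 3))}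
    (h : ∀ t < (0 : ℝ), ∀ y, c • R.symm (v (c ^ 2 * t) (c • R y)) = v t y) :
    ∀ t < (0 : ℝ), ∀ y, c⁻¹ • R.symm.symm (v (c⁻¹ ^ 2 * t) (c⁻¹ • R.symm y)) = v t y := by
  intro t ht y
  have hc2 : 0 < c⁻¹ ^ 2 := by positivity
  have ht' : c⁻¹ ^ 2 * t < 0 := mul_neg_of_pos_of_neg hc2 ht
  have key := h (c⁻¹ ^ 2 * t) ht' (c⁻¹ • R.symm y)
  have e1 : c ^ 2 * (c⁻¹ ^ 2 * t) = t := by field_simp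
  have e2 : c • R (c⁻¹ • R.symm y) = y := by
    rw [LinearIsometryEquiv.map_smul, LinearIsometryEquiv.apply_symm_apply, smul_smul,
      mul_inv_cancel₀ hc.ne', one_smul]
  rw [e1, e2] at key
  -- `key : c • R.symm (v t y) = v (c⁻¹² t) (c⁻¹ R⁻¹ y)`; apply `R` and divide by `c`
  rw [LinearIsometryEquiv.symm_symm, ← key, LinearIsometryEquiv.map_smul,
    LinearIsometryEquiv.apply_symm_apply, smul_smul, inv_mul_cancel₀ hc.ne', one_smul]

/-- **Stub 2a of the line — `stub_periodToRDSS` (registered, skeleton v5).** A scaling period modulo a rigid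
motion, `c u(c²t, cx) = R u(t, R⁻¹(x − b))` on `t < 0` with `c > 0`, `c ≠ 1`, is rotated discrete self-similarity
with blow-up time `0` about a centre `x₀`, with factor `> 1`: centre it (`exists_centre_of_period`, `rdss_of_period`)
and, if `c < 1`, invert it (`rdss_inv`). [folklore] -/
theorem stub_periodToRDSS :
    ∀ (u : ℝ → EuclideanSpace ℝ (Fin 3) → EuclideanSpace ℝ (Fin 3)) (c : ℝ)
      (b : EuclideanSpace ℝ (Fin 3)) (R : EuclideanSpace ℝ (Fin 3) ≃ₗᵢ[ℝ] EuclideanSpace ℝ (Fin 3)),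
      0 < c → c ≠ 1 →
      (∀ t < (0 : ℝ), ∀ x, c • u (c ^ 2 * t) (c • x) = R (u t (R.symm (x - b)))) →
      ∃ (c' : ℝ) (R' : EuclideanSpace ℝ (Fin 3) ≃ₗᵢ[ℝ] EuclideanSpace ℝ (Fin 3)) (x₀ : EuclideanSpace ℝ (Fin 3)),
        1 < c' ∧ ∀ t < (0 : ℝ), ∀ y, c' • R'.symm (u (c' ^ 2 * t) (x₀ + c' • R' y)) = u t (x₀ + y) := by
  intro u c b R hc hc1 hper
  obtain ⟨x₀, hx₀⟩ := exists_centre_of_period hc hc1 R b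
  have hr := rdss_of_period hc hx₀ hper
  rcases lt_or_gt_of_ne hc1 with hlt | hgt
  · refine ⟨c⁻¹, R.symm, x₀, (one_lt_inv₀ hc).2 hlt, fun t ht y => ?_⟩
    simpa using rdss_inv (v := fun t y => u t (x₀ + y)) hc hr t ht y
  · exact ⟨c, R, x₀, hgt, hr⟩

/-! ### Reduction of stub 2 to the bounded-profile RDSS Type-I Liouville wall -/

/-- **A scaling period kills an element of `A_C`, granted the bounded-profile RDSS Type-I Liouville statement.**
Hypothesis `hW` (the wall, spelled out; it is Tsai 2018 Conj. 8.8/8.9 = Bradshaw–Tsai 2017 Open Problem 5.1 for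
BOUNDED profiles in the KNSS gauge, open): every `u ∈ A_C` which is `(c, R)`-rotated-discretely-self-similar
about some `(0, x₀)` on `t < 0` with `c > 1` vanishes on `t < 0`. Conclusion: every `u ∈ A_C` with a scaling
period `S_c u = g_{b,R} u` on `t < 0`, `c > 0`, `c ≠ 1`, vanishes on `t < 0` (centre the period
(`rdss_of_period`), invert it if `c < 1` (`rdss_inv`), apply `hW`). [folklore] -/
theorem period_trivial_of_rdssLiouville
    (hW : ∀ (C : ℝ) (u : ℝ → (EuclideanSpace ℝ (Fin 3)) → (EuclideanSpace ℝ (Fin 3))) (c : ℝ) (R : (EuclideanSpace ℝ (Fin 3)) ≃ₗᵢ[ℝ] (EuclideanSpace ℝ (Fin 3))) (x₀ : (EuclideanSpace ℝ (Fin 3))),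
      (ContDiffOn ℝ (⊤ : ℕ∞) (Function.uncurry u) (Set.Iio 0 ×ˢ Set.univ) ∧
          (∀ t < 0, Literature.Analysis.FluidPDE.VectorCalculus.IsDivFree (u t)) ∧
          (∀ s t : ℝ, s < t → t < 0 → ∀ x, u t x =
            Literature.Analysis.FluidPDE.heatFlow (u s) (t - s) x -
              ∫ τ in Set.Ioo s t, ∫ y,
                Literature.Analysis.FluidPDE.oseenKernel (t - τ) (x - y) (u τ y) (u τ y)) ∧
          Literature.Analysis.FluidPDE.HasTypeITimeDecay C u) →
      1 < c → (∀ t < (0 : ℝ), ∀ y, c • R.symm (u (c ^ 2 * t) (x₀ + c • R y)) = u t (x₀ + y)) →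
      ∀ t < (0 : ℝ), ∀ x, u t x = 0)
    {C : ℝ} {u : ℝ → (EuclideanSpace ℝ (Fin 3)) → (EuclideanSpace ℝ (Fin 3))}
    (hcls : ContDiffOn ℝ (⊤ : ℕ∞) (Function.uncurry u) (Set.Iio 0 ×ˢ Set.univ) ∧
          (∀ t < 0, Literature.Analysis.FluidPDE.VectorCalculus.IsDivFree (u t)) ∧
          (∀ s t : ℝ, s < t → t < 0 → ∀ x, u t x =
            Literature.Analysis.FluidPDE.heatFlow (u s) (t - s) x -
              ∫ τ in Set.Ioo s t, ∫ y,
                Literature.Analysis.FluidPDE.oseenKernel (t - τ) (x - y) (u τ y) (u τ y)) ∧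
          Literature.Analysis.FluidPDE.HasTypeITimeDecay C u)
    {c : ℝ} (hc : 0 < c) (hc1 : c ≠ 1) {b : (EuclideanSpace ℝ (Fin 3))} {R : (EuclideanSpace ℝ (Fin 3)) ≃ₗᵢ[ℝ] (EuclideanSpace ℝ (Fin 3))}
    (hper : ∀ t < (0 : ℝ), ∀ x, c • u (c ^ 2 * t) (c • x) = R (u t (R.symm (x - b)))) :
    ∀ t < (0 : ℝ), ∀ x, u t x = 0 := by
  obtain ⟨x₀, hx₀⟩ := exists_centre_of_period hc hc1 R b
  have hr := rdss_of_period hc hx₀ hper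
  rcases lt_or_gt_of_ne hc1 with hlt | hgt
  · -- `c < 1`: invert the period, the factor `c⁻¹ > 1`
    have hinv := rdss_inv (v := fun t y => u t (x₀ + y)) hc hr
    have hc' : 1 < c⁻¹ := one_lt_inv₀ hc |>.2 hlt
    exact hW C u c⁻¹ R.symm x₀ hcls hc' (fun t ht y => by simpa using hinv t ht y)
  · exact hW C u c R x₀ hcls hgt hr

/-- **Stub 2 of the line from the wall.** Granted the bounded-profile RDSS Type-I Liouville statement `hW` (as in
`period_trivial_of_rdssLiouville`), the registered stub `stub_continuousOfDiscrete` holds — vacuously: an extremal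
pair has `‖u(−1, 0)‖ = C > 0`, while a scaling period modulo a rigid motion forces `u ≡ 0` on `t < 0`. So the
rigidity half of the route's Conjecture M is implied by (indeed is the extremal case of) a NAMED open problem; it
needs neither the attainment nor the minimality clause beyond `C > 0`. [folklore] -/
theorem stub_continuousOfDiscrete_of_rdssLiouville
    (hW : ∀ (C : ℝ) (u : ℝ → (EuclideanSpace ℝ (Fin 3)) → (EuclideanSpace ℝ (Fin 3))) (c : ℝ) (R : (EuclideanSpace ℝ (Fin 3)) ≃ₗᵢ[ℝ] (EuclideanSpace ℝ (Fin 3))) (x₀ : (EuclideanSpace ℝ (Fin 3))),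
      (ContDiffOn ℝ (⊤ : ℕ∞) (Function.uncurry u) (Set.Iio 0 ×ˢ Set.univ) ∧
          (∀ t < 0, Literature.Analysis.FluidPDE.VectorCalculus.IsDivFree (u t)) ∧
          (∀ s t : ℝ, s < t → t < 0 → ∀ x, u t x =
            Literature.Analysis.FluidPDE.heatFlow (u s) (t - s) x -
              ∫ τ in Set.Ioo s t, ∫ y,
                Literature.Analysis.FluidPDE.oseenKernel (t - τ) (x - y) (u τ y) (u τ y)) ∧
          Literature.Analysis.FluidPDE.HasTypeITimeDecay C u) →
      1 < c → (∀ t < (0 : ℝ), ∀ y, c • R.symm (u (c ^ 2 * t) (x₀ + c • R y)) = u t (x₀ + y)) →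
      ∀ t < (0 : ℝ), ∀ x, u t x = 0) :
    ∀ (C : ℝ) (u : ℝ → (EuclideanSpace ℝ (Fin 3)) → (EuclideanSpace ℝ (Fin 3))), 0 < C →
      (ContDiffOn ℝ (⊤ : ℕ∞) (Function.uncurry u) (Set.Iio 0 ×ˢ Set.univ) ∧
          (∀ t < 0, Literature.Analysis.FluidPDE.VectorCalculus.IsDivFree (u t)) ∧
          (∀ s t : ℝ, s < t → t < 0 → ∀ x, u t x =
            Literature.Analysis.FluidPDE.heatFlow (u s) (t - s) x -
              ∫ τ in Set.Ioo s t, ∫ y,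
                Literature.Analysis.FluidPDE.oseenKernel (t - τ) (x - y) (u τ y) (u τ y)) ∧
          Literature.Analysis.FluidPDE.HasTypeITimeDecay C u) ∧
        ‖u (-1) 0‖ = C ∧
        (∀ (C' : ℝ) (u' : ℝ → (EuclideanSpace ℝ (Fin 3)) → (EuclideanSpace ℝ (Fin 3))),
          (ContDiffOn ℝ (⊤ : ℕ∞) (Function.uncurry u') (Set.Iio 0 ×ˢ Set.univ) ∧
            (∀ t < 0, Literature.Analysis.FluidPDE.VectorCalculus.IsDivFree (u' t)) ∧
            (∀ s t : ℝ, s < t → t < 0 → ∀ x, u' t x =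
              Literature.Analysis.FluidPDE.heatFlow (u' s) (t - s) x -
                ∫ τ in Set.Ioo s t, ∫ y,
                  Literature.Analysis.FluidPDE.oseenKernel (t - τ) (x - y) (u' τ y) (u' τ y)) ∧
            Literature.Analysis.FluidPDE.HasTypeITimeDecay C' u') →
          (∃ t < 0, ∃ x, u' t x ≠ 0) → C ≤ C') →
      (∃ c : ℝ, 0 < c ∧ c ≠ 1 ∧ ∃ (b : (EuclideanSpace ℝ (Fin 3))) (R : (EuclideanSpace ℝ (Fin 3)) ≃ₗᵢ[ℝ] (EuclideanSpace ℝ (Fin 3))),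
        ∀ t < 0, ∀ x, c • u (c ^ 2 * t) (c • x) = R (u t (R.symm (x - b)))) →
      ∃ δ₀ : ℝ, 0 < δ₀ ∧ ∀ c : ℝ, |c - 1| < δ₀ →
        ∃ (δ : ℝ) (b : (EuclideanSpace ℝ (Fin 3))) (R : (EuclideanSpace ℝ (Fin 3)) ≃ₗᵢ[ℝ] (EuclideanSpace ℝ (Fin 3))), 0 ≤ δ ∧
          ∀ t < 0, ∀ x, c • u (c ^ 2 * t) (c • x) = R (u (t - δ) (R.symm (x - b))) := by
  intro C u hC hext hper
  obtain ⟨hcls, hnorm, -⟩ := hext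
  obtain ⟨c, hc, hc1, b, R, hper⟩ := hper
  have h0 := period_trivial_of_rdssLiouville hW hcls hc hc1 hper (-1) (by norm_num) 0
  rw [h0, norm_zero] at hnorm
  exact absurd hnorm hC.ne

/-! ### The space-decaying part of the wall is the catalogued conjecture -/

/-- **Under `TypeIDSSLiouvilleConjecture`, space-decaying RDSS elements of `A_C` vanish.** Assuming the tree's
conjecture leaf `TypeIDSSLiouvilleConjecture` (`∀ c, TypeIDSSLiouville c ∧ ∀ R, RotatedTypeIDSSLiouville c R`;
hypothesis), every `u ∈ A_C` which is `(c, R)`-rotated-discretely-self-similar about `(0, x₀)` on `t < 0` with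
`c > 1` and obeys a space–time Type-I bound about `x₀` vanishes on `t < 0`: the truncation to `t < 0` of the
translate `u(·, x₀ + ·)` lies in `A_{2C}` (`isTypeIAncientMild_truncate`), so it is an ancient mild solution in
the duality sense with measurable slices, it is `(c, R)`-RDSS at all times and keeps the bound; the rotated half of
the conjecture makes its slices a.e. zero, and continuous slices a.e. zero are zero. CONDITIONAL on the conjecture.
[cite: BradshawTsai2017CPDE, §5 Open Problem 5.1] -/
theorem rdss_trivial_of_spaceDecay_of_conjecture
    (hConj : _root_.Summit.NavierStokesRegularity.NavierStokesRegularity.TypeIDSSLiouvilleConjecture) :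
    ∀ (C : ℝ) (u : ℝ → (EuclideanSpace ℝ (Fin 3)) → (EuclideanSpace ℝ (Fin 3))) (c : ℝ) (R : (EuclideanSpace ℝ (Fin 3)) ≃ₗᵢ[ℝ] (EuclideanSpace ℝ (Fin 3))) (x₀ : (EuclideanSpace ℝ (Fin 3))),
      (ContDiffOn ℝ (⊤ : ℕ∞) (Function.uncurry u) (Set.Iio 0 ×ˢ Set.univ) ∧
          (∀ t < 0, Literature.Analysis.FluidPDE.VectorCalculus.IsDivFree (u t)) ∧
          (∀ s t : ℝ, s < t → t < 0 → ∀ x, u t x =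
            Literature.Analysis.FluidPDE.heatFlow (u s) (t - s) x -
              ∫ τ in Set.Ioo s t, ∫ y,
                Literature.Analysis.FluidPDE.oseenKernel (t - τ) (x - y) (u τ y) (u τ y)) ∧
          Literature.Analysis.FluidPDE.HasTypeITimeDecay C u) →
      1 < c → (∀ t < (0 : ℝ), ∀ y, c • R.symm (u (c ^ 2 * t) (x₀ + c • R y)) = u t (x₀ + y)) →
      (∃ C₀ : ℝ, ∀ t < (0 : ℝ), ∀ y, ‖u t (x₀ + y)‖ ≤ C₀ / (‖y‖ + Real.sqrt (-t))) →
      ∀ t < (0 : ℝ), ∀ x, u t x = 0 := by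
  intro C u c R x₀ hcls hc hdss hdec t ht x
  have hA : IsTypeIAncientMild C u := isTypeIAncientMild_iff.2 hcls
  have hAv : IsTypeIAncientMild C (fun t y => u t (x₀ + y)) :=
    Summit.NavierStokesRegularity.NavierStokesRegularity.Theorems.isTypeIAncientMild_translate hA x₀
  -- truncate the translate to the past
  obtain ⟨v, hv⟩ : ∃ v : ℝ → (EuclideanSpace ℝ (Fin 3)) → (EuclideanSpace ℝ (Fin 3)),
      v = fun s => if s < 0 then (fun y => u s (x₀ + y)) else 0 := ⟨_, rfl⟩
  have hv_neg : ∀ s < 0, v s = fun y => u s (x₀ + y) := fun s hs => by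
    rw [hv]
    exact if_pos hs
  have hv_nonneg : ∀ s : ℝ, ¬ s < 0 → v s = 0 := fun s hs => by
    rw [hv]
    exact if_neg hs
  have hvclass : IsTypeIAncientMild (2 * C) v :=
    hv ▸ Summit.NavierStokesRegularity.NavierStokesRegularity.Theorems.SymmetryModuliCountSymmetricLiouville.isTypeIAncientMild_truncate hAv
  have hrdss : IsRotatedDSS c R v := by
    intro s y
    by_cases hs : s < 0
    · have hcs : c ^ 2 * s < 0 := mul_neg_of_pos_of_neg (by positivity) hs
      rw [hv_neg s hs, hv_neg _ hcs]
      exact hdss s hs y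
    · have hcs : ¬ c ^ 2 * s < 0 := not_lt.2 (mul_nonneg (sq_nonneg _) (not_lt.1 hs))
      rw [hv_nonneg s hs, hv_nonneg _ hcs]
      simp
  have hmeas : ∀ s < 0, AEStronglyMeasurable (v s) volume := fun s hs =>
    hvclass.aestronglyMeasurable_slice hs
  have hdec' : ∃ C₀ : ℝ, HasTypeIDecay C₀ v := by
    obtain ⟨C₀, hC₀⟩ := hdec
    refine ⟨C₀, fun s hs y => ?_⟩
    rw [hv_neg s hs]
    exact hC₀ s hs y
  have hae : v t =ᵐ[volume] 0 :=
    (hConj c).2 R hc v hvclass.isAncientMildSolution hmeas hrdss hdec' t ht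
  rw [hv_neg t ht] at hae
  have h0 : (fun y => u t (x₀ + y)) = 0 :=
    (Continuous.ae_eq_iff_eq volume (hAv.continuous_slice ht) continuous_const).1 hae
  have := congr_fun h0 (x - x₀)
  simpa using this

/-! ### The proved rung: `R = 1`, factor near `1`, space–time decay (Chae–Wolf 2017, Thm 1.3) -/

/-- Truncation to the past keeps a classical solution on `(−∞, 0)` classical: replacing the velocity by `0` for
`t ≥ 0` changes neither the smoothness on `Iio 0 ×ˢ univ`, nor the one-sided time derivative within `Iio 0`, nor
the slices at negative times. [folklore] -/
-- adapted from Theorems/RellichScarSymmetricScarExistsDssNearOne.lean (`isClassicalNSSolutionOn_truncate`),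
-- copied rather than imported to keep this file's imports light
theorem isClassicalNSSolutionOn_truncate' {V : ℝ → (EuclideanSpace ℝ (Fin 3)) → (EuclideanSpace ℝ (Fin 3))} {Q : ℝ → (EuclideanSpace ℝ (Fin 3)) → ℝ}
    (hcl : IsClassicalNSSolutionOn (Iio (0 : ℝ)) 1 0 V Q) :
    IsClassicalNSSolutionOn (Iio (0 : ℝ)) 1 0 (fun t x => if t < 0 then V t x else 0) Q := by
  have hslice : ∀ t : ℝ, t < 0 → (fun x => if t < 0 then V t x else (0 : (EuclideanSpace ℝ (Fin 3)))) = V t :=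
    fun t ht => funext fun x => if_pos ht
  refine ⟨?_, hcl.smooth_pressure, fun t ht x => ?_, fun t ht => ?_⟩
  · refine (hcl.smooth_velocity).congr ?_
    rintro ⟨t, x⟩ ⟨ht, -⟩
    simp only [Function.uncurry_apply_pair, if_pos (show t < 0 from ht)]
  · have hm := hcl.momentum t ht x
    have hder : timeDerivWithin (Iio (0 : ℝ)) (fun s y => if s < 0 then V s y else 0) t x =
        timeDerivWithin (Iio (0 : ℝ)) V t x := by
      simp only [timeDerivWithin_apply]
      exact derivWithin_congr (fun s hs => by simp only [if_pos (show s < 0 from hs)])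
        (by simp only [if_pos (show t < 0 from ht)])
    rw [hder, hslice t ht]
    exact hm
  · rw [hslice t ht]
    exact hcl.divFree t ht

/-- **The known rung of the wall inside `A_C` (Chae–Wolf 2017, Theorem 1.3).** For every `C₀ > 0` there is
`c₁ > 1` such that: if `u ∈ A_C` (any `C`) is `c`-discretely self-similar about `(0, x₀)` on `t < 0` with trivial
rotation, `c u(c²t, x₀ + cy) = u(t, x₀ + y)`, with `1 < c < c₁`, and obeys the SPACE–time Type-I bound about `x₀`,
`‖u(t, x₀ + y)‖ ≤ C₀/(‖y‖ + √(−t))`, then `u ≡ 0` on `t < 0`. Proof: the translate `v = u(·, x₀ + ·)` is again in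
`A_C` (`isTypeIAncientMild_translate`), hence classical on `(−∞,0)` for one smooth pressure (`stub_ancientPressure`);
its truncation to `t < 0` is an everywhere `c`-DSS classical solution with the bound, so it vanishes by the tree's
discharge `chaeWolf2017_removing_dss_holds`. [cite: ChaeWolf2017RemovingDSS, Theorem 1.3 (arXiv:1610.09464 p. 3)] -/
theorem rdss_trivial_nearOne_of_spaceDecay (C₀ : ℝ) (hC₀ : 0 < C₀) :
    ∃ c₁ : ℝ, 1 < c₁ ∧ ∀ c : ℝ, 1 < c → c < c₁ →
      ∀ (C : ℝ) (u : ℝ → (EuclideanSpace ℝ (Fin 3)) → (EuclideanSpace ℝ (Fin 3))) (x₀ : (EuclideanSpace ℝ (Fin 3))),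
        (ContDiffOn ℝ (⊤ : ℕ∞) (Function.uncurry u) (Set.Iio 0 ×ˢ Set.univ) ∧
          (∀ t < 0, Literature.Analysis.FluidPDE.VectorCalculus.IsDivFree (u t)) ∧
          (∀ s t : ℝ, s < t → t < 0 → ∀ x, u t x =
            Literature.Analysis.FluidPDE.heatFlow (u s) (t - s) x -
              ∫ τ in Set.Ioo s t, ∫ y,
                Literature.Analysis.FluidPDE.oseenKernel (t - τ) (x - y) (u τ y) (u τ y)) ∧
          Literature.Analysis.FluidPDE.HasTypeITimeDecay C u) →
        (∀ t < (0 : ℝ), ∀ y, c • u (c ^ 2 * t) (x₀ + c • y) = u t (x₀ + y)) →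
        (∀ t < (0 : ℝ), ∀ y, ‖u t (x₀ + y)‖ ≤ C₀ / (‖y‖ + Real.sqrt (-t))) →
        ∀ t < (0 : ℝ), ∀ x, u t x = 0 := by
  obtain ⟨c₁, hc₁, hcw⟩ := chaeWolf2017_removing_dss_holds C₀ hC₀
  refine ⟨c₁, hc₁, fun c hc hcc C u x₀ hcls hdss hdec t ht x => ?_⟩
  -- the translate is in the class, hence classical on `(−∞, 0)` with one pressure
  have hA : IsTypeIAncientMild C u := isTypeIAncientMild_iff.2 hcls
  have hAv : IsTypeIAncientMild C (fun t y => u t (x₀ + y)) :=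
    Summit.NavierStokesRegularity.NavierStokesRegularity.Theorems.isTypeIAncientMild_translate hA x₀
  obtain ⟨q, hcl⟩ :=
    Summit.NavierStokesRegularity.NavierStokesRegularity.Theorems.stub_ancientPressure C _ hAv
  -- truncate to the past
  set w : ℝ → (EuclideanSpace ℝ (Fin 3)) → (EuclideanSpace ℝ (Fin 3)) := fun t y => if t < 0 then u t (x₀ + y) else 0 with hw
  have hclw : IsClassicalNSSolutionOn (Iio (0 : ℝ)) 1 0 w q := isClassicalNSSolutionOn_truncate' hcl
  have hdssw : IsDiscretelySelfSimilar c w := by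
    funext s y
    simp only [nsRescale_apply, hw]
    by_cases hs : s < 0
    · have hs' : c ^ 2 * s < 0 := mul_neg_of_pos_of_neg (by positivity) hs
      rw [if_pos hs', if_pos hs]
      exact hdss s hs y
    · have hs' : ¬ c ^ 2 * s < 0 := by
        intro h'
        exact hs (by nlinarith [sq_nonneg c, pow_pos (zero_lt_one.trans hc) 2])
      rw [if_neg hs', if_neg hs, smul_zero]
  have hdecw : HasTypeIDecay C₀ w := by
    intro s hs y
    simp only [hw, if_pos hs]
    exact hdec s hs y
  have hzero := hcw c hc hcc w q hclw hdssw hdecw t ht (x - x₀)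
  simpa [hw, if_pos ht] using hzero

end Summit.NavierStokesRegularity.NavierStokesRegularity.Theorems.ExtremalSpiralSymmetry.Registered

end
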